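import Summits.QuantumFields.YangMills.Theorems.BalabanUVNodesN15KingModelGraphTreeDecayContinuumLegsTree

/-!
# BalabanUVNodes ∕ N15 — THE KING-MODEL RUNG (PART Β-j): TREE DECAY OF THE CONTINUUM n-POINT KERNEL AT THE FULL RATE — `exp[−δ·d_tree^{(∞)}({b_υ})]` WITH
# `d_tree^{(∞)} := inf_K d_tree^{(K)}` (the infimum over the scales of King's «shortest tree graph» lengths), ITS TWO VOLUME-UNIFORM LOWER BOUNDS, AND THE LIMIT
# THEOREMS OF PARTS Β-h∕Β-i RE-READ WITH THIS FACTOR, BY NAME AT `A = 0`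
# (Track A, DAG node N15 = NE2; FAN-OUT v1.1 §N15 s3 «KING-MODEL RUNG … NE2's analogue DECIDED in the model»)

HONEST FRAMING.  Count-neutral (cell `pub-ymgap`, seat `pub-ymgap-dag-n15-e` g30; `--supports stmt-QuantumFields-27366 --as helper` = K3⁸
`SpineGivenEndpointR13SepCoPHV`).  TEMPLATE LITERATURE: C. King, *The U(1) Higgs model. I. The continuum limit*, Commun. Math. Phys. **102** (1986) 649–677
[King1986]: Theorem 3.5 (3.38) p. 660 ∕ Proposition 3.6 (3.56) p. 662 (`exp[−δ dist({y_i})]`, `dist` = «the length of the shortest tree graph connecting {u_i}», p. 660),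
Theorem 2.1 (i) (2.22) p. 654 — for ONE DIAGRAM's n-point kernel in KING's OWN `A = 0` MODEL along `K` (part Β-h `kingLegSeq`).  NOT `Z`, NOT Bałaban's `G(U)`, NOT a node
discharge; nothing continuum-ℝ⁴ ∕ OS ∕ mass-gap ∕ Clay.  0 `sorry`; standard axioms; one plumbing `def` (the infimum).  Pages re-read 2026-08-29.

THE PRINT.  p. 660 [PDF 12]: *«We define dist({u_i}) to be the length of the shortest tree graph connecting {u_i}»*; (3.38)∕(3.56): *«… exp[−δ dist({y_i}, …)]»*.

READING (declared; ours).  At scale `K` the tree length `d_tree^{(K)} = treeLength |·|_{η} {y^{(K)}_{b_υ}}` is measured on `T_η` in unit-block units (part Α-b).  Define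
`d_tree^{(∞)}({b_υ}) := ⨅_K d_tree^{(K)}` (`kingTreeDistInf`; every term `≥ 0`).  Trivially `e^{−δ d_tree^{(K)}} ≤ e^{−δ d_tree^{(∞)}}` for EVERY `K` — so parts Α-l ∕ Α-g's
tree factors are `K`-UNIFORM at the FULL rate `δ` when read against `d_tree^{(∞)}`; and `d_tree^{(∞)}` is NOT degenerate: (i) `d_tree^{(∞)} ≥ |b_{υ₁} − b_{υ₂}|_T − 1` for every
pair (tree ≥ pair on each `T_η`, base points `≥ |b − b′|_T − 1` apart), (ii) `|Υ|·(d_tree^{(∞)} + 1) ≥ treeLength |·|_T (b(Υ))` (the star bound of part Β-i).  Hence ★★★ the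
continuum n-point kernel obeys `|E^{(∞)}(G; {b_υ})| ≤ S_G Q^{|Υ|−1}·exp[−δ′·d_tree^{(∞)}({b_υ})]` and `|E^{(K+1)} − E^{(∞)}| ≤ (B_G L^{−γ} exp[−δ·d_tree^{(∞)}])(L^{−γ})^K∕(1−L^{−γ})` —
(3.38)∕(3.56)'s `exp[−δ dist]` for the limit with NO loss of rate; §4: NO hypothesis for connected pseudoforests of `G`-lines in `1 ≤ d ≤ 3`.

WHAT THIS FILE PROVES (namespace `Summit.QuantumFields.YangMills.BalabanUVNodes.N15KingModelRung.Curved`).  §1 `kingTreeDistInf`, `kingTreeDistInf_nonneg`,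
★ `kingTreeDistInf_le` (`≤ d_tree^{(K)}`), ★ `exp_treeLength_le_exp_inf`, ★ `tdistT_le_kingTreeDistInf_add_one` (pair lower bound), ★ `treeLength_unit_le_card_mul`
(star comparison).  §2 ★ `kingLegSeq_succ_sub_le_inf`, ★ `kingLegSeq_abs_le_inf`.  §3 ★★ **`king_graphLegs_continuumLimit_inf`**, ★★★ **`king_graphLegs_limit_treeDecayInf`**.
§4 ★★ `king_pseudoforestLegs_limit_treeDecayInf`.

HONEST SCOPE.  (a) `d_tree^{(∞)}` is an infimum of lattice tree lengths over the scales — NOT identified here with a continuum Steiner length in a torus norm (that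
identification is not typed); its content is fixed by the two lower bounds (i)–(ii).  (b) One diagram of King's `A = 0` model at fixed torus; legs = the two kernel
members of (3.71); p. 664's sentence the hypothesis of §3; §3.5 not typed.  (c) NOT Bałaban's `G(U)`; N15 untouched; counts unmoved.
Locators: [King1986] p.660 (dist), Thm 3.5 (3.38) p.660, Prop. 3.6 (3.56) p.662, Thm 2.1 (i) (2.22) p.654, (3.13) p.657, p.664.
-/

noncomputable section

open scoped BigOperators Topology
open Finset Filter

namespace Summit.QuantumFields.YangMills.BalabanUVNodes.N15KingModelRung.Curved

open Literature.MathematicalPhysics.QuantumFieldTheory.Balaban1983to89.B5Prop11Plancherel (Tor fine)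
open Literature.MathematicalPhysics.QuantumFieldTheory.King1986.Torus (tdistT tdistT_nonneg)
open Summit.QuantumFields.YangMills.BalabanUVNodes.N15KingModelRung (KingVolIndex kingVol kingVol_neZero basePt blockOf_basePt)
open Summit.QuantumFields.YangMills.BalabanUVNodes.N15KingModelRung.Graph

variable {d : ℕ} (L : ℕ) [NeZero L]

/-! ## §1 The infimum over scales of the tree lengths, and its two lower bounds -/

section Inf

/-- **`d_tree^{(∞)}({b_υ}) := ⨅_K treeLength |·|_η {y^{(K)}_{b_υ}}`** — the infimum over the scales `K + 1` (`η = L^{−(K+1)}`, torus `2L^{e_M}`) of King's tree lengths of the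
base points of the unit sites `b_υ` (part Α-b `treeLength`, part Α-e `kingDist`). [cite: King1986, p.660 («the length of the shortest tree graph connecting {u_i}»)] -/
def kingTreeDistInf (eM : ℕ) {Υ : Type} [Fintype Υ] (b : Υ → Tor (kingVol L (jvSucc (d := d) eM 0))) : ℝ :=
  ⨅ K : ℕ, (haveI := kingVol_neZero L (jvSucc (d := d) eM K)
    treeLength (kingDist L (jvSucc (d := d) eM K)) (anchors fun υ => some (basePt (L ^ (K + 1)) (kingVol L (jvSucc (d := d) eM K)) (b υ))))

/-- `0 ≤ d_tree^{(∞)}`. [cite: King1986, p.660] -/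
theorem kingTreeDistInf_nonneg (eM : ℕ) {Υ : Type} [Fintype Υ] (b : Υ → Tor (kingVol L (jvSucc (d := d) eM 0))) : 0 ≤ kingTreeDistInf L eM b :=
  Real.iInf_nonneg fun K => by
    haveI := kingVol_neZero L (jvSucc (d := d) eM K)
    exact treeLength_nonneg (fun x y => kingDist_nonneg L _ x y) _

/-- ★ `d_tree^{(∞)} ≤ d_tree^{(K)}` for every `K`. [cite: King1986, p.660] -/
theorem kingTreeDistInf_le (eM : ℕ) {Υ : Type} [Fintype Υ] (b : Υ → Tor (kingVol L (jvSucc (d := d) eM 0))) (K : ℕ) :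
    haveI := kingVol_neZero L (jvSucc (d := d) eM K)
    kingTreeDistInf L eM b ≤ treeLength (kingDist L (jvSucc (d := d) eM K)) (anchors fun υ => some (basePt (L ^ (K + 1)) (kingVol L (jvSucc (d := d) eM K)) (b υ))) := by
  unfold kingTreeDistInf
  refine ciInf_le ⟨0, ?_⟩ K
  rintro _ ⟨K', rfl⟩
  haveI := kingVol_neZero L (jvSucc (d := d) eM K')
  exact treeLength_nonneg (fun x y => kingDist_nonneg L _ x y) _

/-- ★ **THE TREE FACTOR AT EVERY SCALE IS DOMINATED BY THE FULL-RATE FACTOR IN `d_tree^{(∞)}`**: `exp[−δ·d_tree^{(K)}] ≤ exp[−δ·d_tree^{(∞)}]` (`δ ≥ 0`).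
[cite: King1986, (3.56) p.662, p.660] -/
theorem exp_treeLength_le_exp_inf (eM : ℕ) {Υ : Type} [Fintype Υ] (b : Υ → Tor (kingVol L (jvSucc (d := d) eM 0))) (K : ℕ) {δ : ℝ} (hδ : 0 ≤ δ) :
    haveI := kingVol_neZero L (jvSucc (d := d) eM K)
    Real.exp (-(δ * treeLength (kingDist L (jvSucc (d := d) eM K)) (anchors fun υ => some (basePt (L ^ (K + 1)) (kingVol L (jvSucc (d := d) eM K)) (b υ)))))
      ≤ Real.exp (-(δ * kingTreeDistInf L eM b)) :=
  Real.exp_le_exp.2 (neg_le_neg (mul_le_mul_of_nonneg_left (kingTreeDistInf_le L eM b K) hδ))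

/-- ★ **PAIR LOWER BOUND**: `|b_{υ₁} − b_{υ₂}|_T ≤ d_tree^{(∞)}({b_υ}) + 1` for every pair (tree ≥ pair on each `T_η`, part Α-f; base points `≥ |b − b′|_T − 1` apart, part Ψ).
[cite: King1986, p.660, (3.56) p.662] -/
theorem tdistT_le_kingTreeDistInf_add_one (eM : ℕ) {Υ : Type} [Fintype Υ] (b : Υ → Tor (kingVol L (jvSucc (d := d) eM 0))) (υ₁ υ₂ : Υ) :
    haveI := kingVol_neZero L (jvSucc (d := d) eM 0)
    tdistT (kingVol L (jvSucc (d := d) eM 0)) (b υ₁) (b υ₂) ≤ kingTreeDistInf L eM b + 1 := by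
  haveI := kingVol_neZero L (jvSucc (d := d) eM 0)
  rw [← sub_le_iff_le_add]
  unfold kingTreeDistInf
  refine le_ciInf fun K => ?_
  set jv : KingVolIndex d := jvSucc (d := d) eM K with hjv
  haveI := kingVol_neZero L jv
  have hL0 : (0 : ℝ) < L := by exact_mod_cast Nat.pos_of_ne_zero (NeZero.ne L)
  have hN : (0 : ℝ) < (L : ℝ) ^ jv.K := pow_pos hL0 _
  have hpair := kingDist_le_treeLength_anchors L jv (fun υ => some (basePt (L ^ jv.K) (kingVol L jv) (b υ))) (υ₁ := υ₁) (υ₂ := υ₂)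
    (y₁ := basePt (L ^ jv.K) (kingVol L jv) (b υ₁)) (y₂ := basePt (L ^ jv.K) (kingVol L jv) (b υ₂)) rfl rfl
  have h := mul_tdistT_blockOf_le (L ^ jv.K) (kingVol L jv) (basePt (L ^ jv.K) (kingVol L jv) (b υ₁)) (basePt (L ^ jv.K) (kingVol L jv) (b υ₂))
  rw [blockOf_basePt, blockOf_basePt] at h
  push_cast at h
  have hdist : tdistT (kingVol L jv) (b υ₁) (b υ₂) ≤ kingDist L jv (basePt (L ^ jv.K) (kingVol L jv) (b υ₁)) (basePt (L ^ jv.K) (kingVol L jv) (b υ₂)) + 1 := by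
    unfold kingDist
    rw [← sub_le_iff_le_add, le_div_iff₀ hN]
    nlinarith
  show tdistT (kingVol L jv) (b υ₁) (b υ₂) - 1 ≤ _
  calc tdistT (kingVol L jv) (b υ₁) (b υ₂) - 1
      ≤ kingDist L jv (basePt (L ^ jv.K) (kingVol L jv) (b υ₁)) (basePt (L ^ jv.K) (kingVol L jv) (b υ₂)) := by linarith
    _ ≤ _ := hpair

/-- ★ **STAR COMPARISON**: `treeLength |·|_T (b(Υ)) ≤ |Υ|·(d_tree^{(∞)}({b_υ}) + 1)` (every leg site within `d_tree^{(K)} + 1` of a root site `b_{υ₀}`; star bound of part Α-m;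
then the infimum). [cite: King1986, p.660] -/
theorem treeLength_unit_le_card_mul (eM : ℕ) {Υ : Type} [Fintype Υ] [DecidableEq Υ] (b : Υ → Tor (kingVol L (jvSucc (d := d) eM 0))) (υ₀ : Υ) :
    haveI := kingVol_neZero L (jvSucc (d := d) eM 0)
    treeLength (tdistT (kingVol L (jvSucc (d := d) eM 0))) (univ.image b) ≤ (Fintype.card Υ : ℝ) * (kingTreeDistInf L eM b + 1) := by
  haveI := kingVol_neZero L (jvSucc (d := d) eM 0)
  refine (treeLength_le_sum_dist (tdistT (kingVol L (jvSucc (d := d) eM 0))) (univ.image b) (b υ₀)).trans ?_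
  have htf0 := kingTreeDistInf_nonneg L eM b
  calc ∑ u ∈ univ.image b, tdistT (kingVol L (jvSucc (d := d) eM 0)) u (b υ₀) ≤ ∑ _u ∈ univ.image b, (kingTreeDistInf L eM b + 1) :=
        sum_le_sum fun u hu => by obtain ⟨υ, -, rfl⟩ := mem_image.1 hu; exact tdistT_le_kingTreeDistInf_add_one L eM b υ υ₀
    _ = ((univ.image b).card : ℝ) * (kingTreeDistInf L eM b + 1) := by rw [sum_const, nsmul_eq_mul]
    _ ≤ (Fintype.card Υ : ℝ) * (kingTreeDistInf L eM b + 1) := by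
        refine mul_le_mul_of_nonneg_right ?_ (by linarith)
        exact_mod_cast card_image_le.trans (card_univ (α := Υ)).le

end Inf

/-! ## §2 The n-point kernel along `K` with the full-rate factor -/

section Bounds

/-- ★ **CONSECUTIVE DIFFERENCES WITH THE FULL-RATE TREE FACTOR**: with part Α-g's `(A, γ, δ)`, under p. 664's sentence, for every `K`:
`|E^{(K+2)}(G; {y_b}) − E^{(K+1)}(G; {y_b})| ≤ ((e^{0}·A^{2m+nn+|Υ|}m!(m+|Υ|+1))·L^{−γ}·exp[−δ·d_tree^{(∞)}({b_υ})])·(L^{−γ})^K` (no `e^{δ}`, no `|Υ|` in the rate).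
[cite: King1986, Prop. 3.6 (3.56) p.662, p.660, (3.10)–(3.11) p.656] -/
theorem kingLegSeq_succ_sub_le_inf (hLodd : Odd L) (hL : 2 ≤ L) {a : ℝ} (ha : 0 < a) {m0sq : ℝ} (hm0 : 0 ≤ m0sq) :
    ∃ A γ δ : ℝ, 1 ≤ A ∧ 0 < γ ∧ 0 < δ ∧ ∀ (msq : ℝ), 0 < msq → msq ≤ m0sq → ∀ (eM nn m : ℕ) (src tgt : Fin m → Fin (nn + 1)), (∀ v, LConn src tgt univ 0 v) →
      ∀ (κ : Fin m → Option (Fin (d + 1))), PosSubgraphsBy src tgt 0 ((d + 1 : ℕ) : ℝ) (fun ℓ => lineExp (d + 1) (κ ℓ)) →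
      ∀ (Υ : Type) [Fintype Υ] [DecidableEq Υ] (vtx : Υ → Fin (nn + 1)) (υ₀ : Υ), vtx υ₀ = 0 →
      ∀ (b : Υ → Tor (kingVol L (jvSucc (d := d) eM 0))) (κe : Υ → Option (Fin (d + 1))) (K : ℕ),
        |kingLegSeq L a msq eM nn m src tgt κ Υ vtx b κe (K + 1) - kingLegSeq L a msq eM nn m src tgt κ Υ vtx b κe K|
          ≤ ((A ^ (2 * m + nn + Fintype.card Υ) * ((m.factorial : ℝ) * (m + Fintype.card Υ + 1))) * (L : ℝ) ^ (-γ)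
              * Real.exp (-(δ * kingTreeDistInf L eM b))) * ((L : ℝ) ^ (-γ)) ^ K := by
  obtain ⟨A, γ, δ, hA, hγ, hδ, H⟩ := king_prop36_extLegs_treeDecay_collected (d := d) L hLodd hL ha hm0
  refine ⟨A, γ, δ, hA, hγ, hδ, fun msq hm hcap eM nn m src tgt hconn κ hsub Υ _ _ vtx υ₀ hυ₀ b κe K => ?_⟩
  set jv : KingVolIndex d := jvSucc (d := d) eM K with hjv
  haveI := kingVol_neZero L jv
  have hL0 : (0 : ℝ) < L := by exact_mod_cast (show 0 < L by omega)
  have key := H msq hm hcap jv 1 le_rfl nn m src tgt hconn κ hsub Υ vtx υ₀ hυ₀ b κe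
  have hlegs : (fun υ => kingExtLo L a msq (jvSucc (d := d) eM (K + 1)) (b υ) (κe υ)) = fun υ => kingExtHi L a msq jv 1 (b υ) (κe υ) :=
    funext fun υ => funext fun x' => (kingExtHi_jvSucc_eq L a msq eM K (b υ) (κe υ) x').symm
  have hdiff : kingLegSeq L a msq eM nn m src tgt κ Υ vtx b κe (K + 1) - kingLegSeq L a msq eM nn m src tgt κ Υ vtx b κe K
      = graphValLS ((((L : ℝ) ^ (jv.K + 1))⁻¹) ^ (d + 1)) src tgt (fun ℓ => kingGLine L (kingVol L jv) a msq (jv.K + 1) (κ ℓ)) vtx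
            (fun υ => kingExtHi L a msq jv 1 (b υ) (κe υ))
        - graphValLS ((((L : ℝ) ^ jv.K)⁻¹) ^ (d + 1)) src tgt (fun ℓ => kingGLine L (kingVol L jv) a msq jv.K (κ ℓ)) vtx
            (fun υ => kingExtLo L a msq jv (b υ) (κe υ)) := by
    unfold kingLegSeq
    rw [hlegs]
    rfl
  rw [hdiff]
  have htree := exp_treeLength_le_exp_inf L eM b K hδ.le
  have hpow : (L : ℝ) ^ (-(γ * (jv.K : ℕ))) = (L : ℝ) ^ (-γ) * ((L : ℝ) ^ (-γ)) ^ K := by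
    rw [show (-(γ * (jv.K : ℕ)) : ℝ) = (-γ) * ((K + 1 : ℕ) : ℝ) from by simp only [hjv, jvSucc]; ring,
      Real.rpow_mul (Nat.cast_nonneg L), Real.rpow_natCast, pow_succ, mul_comm]
  have hθ0 : 0 ≤ (L : ℝ) ^ (-(γ * (jv.K : ℕ))) := Real.rpow_nonneg hL0.le _
  have hC0 : 0 ≤ A ^ (2 * m + nn + Fintype.card Υ) * ((m.factorial : ℝ) * (m + Fintype.card Υ + 1)) := by
    have := zero_le_one.trans hA; positivity
  calc _ ≤ _ := key
    _ ≤ Real.exp (-(δ * kingTreeDistInf L eM b)) * (L : ℝ) ^ (-(γ * (jv.K : ℕ)))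
          * (A ^ (2 * m + nn + Fintype.card Υ) * ((m.factorial : ℝ) * (m + Fintype.card Υ + 1))) :=
        mul_le_mul_of_nonneg_right (mul_le_mul_of_nonneg_right htree hθ0) hC0
    _ = _ := by rw [hpow]; ring

/-- ★ **A UNIFORM SIZE WITH THE FULL-RATE TREE FACTOR**: with part Α-l's `(C₁, C₂, Q, δ′)`, under p. 664's sentence, for every `K`:
`|E^{(K+1)}(G; {y_b})| ≤ ((Q·c368 δ′)·C₁^m C₂^{nn}·(Σ_π degConst)·Q^{|Υ|−1})·exp[−δ′·d_tree^{(∞)}({b_υ})]` — (3.38)'s `exp[−δ dist]` verbatim in shape.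
[cite: King1986, Thm 3.5 (3.38) p.660, p.660 (dist), p.664] -/
theorem kingLegSeq_abs_le_inf (hLodd : Odd L) (hL : 2 ≤ L) {a : ℝ} (ha : 0 < a) {m0sq : ℝ} (hm0 : 0 ≤ m0sq) :
    ∃ C₁ C₂ Q δ : ℝ, 0 < C₁ ∧ 0 < C₂ ∧ 0 < Q ∧ 0 < δ ∧ ∀ (msq : ℝ), 0 < msq → msq ≤ m0sq →
      ∀ (eM nn m : ℕ) (src tgt : Fin m → Fin (nn + 1)), (∀ v, LConn src tgt univ 0 v) →
      ∀ (κ : Fin m → Option (Fin (d + 1))), PosSubgraphsBy src tgt 0 ((d + 1 : ℕ) : ℝ) (fun ℓ => lineExp (d + 1) (κ ℓ)) →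
      ∀ (Υ : Type) [Fintype Υ] [DecidableEq Υ] (vtx : Υ → Fin (nn + 1)) (υ₀ : Υ), vtx υ₀ = 0 →
      ∀ (b : Υ → Tor (kingVol L (jvSucc (d := d) eM 0))) (κe : Υ → Option (Fin (d + 1))) (K : ℕ),
        |kingLegSeq L a msq eM nn m src tgt κ Υ vtx b κe K|
          ≤ ((Q * c368 d δ) * (C₁ ^ m * C₂ ^ nn
                * (∑ π : Equiv.Perm (Fin m), degConst L (kingDegList src tgt ((d + 1 : ℕ) : ℝ) (fun ℓ => lineExp (d + 1) (κ ℓ)) π))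
                * Q ^ (Fintype.card Υ - 1))) * Real.exp (-(δ * kingTreeDistInf L eM b)) := by
  obtain ⟨C₁, C₂, Q, δ, hC₁, hC₂, hQ, hδ, H⟩ := king_graph_size_extLegs_treeDecay_subgraphs (d := d) L hLodd hL ha hm0
  refine ⟨C₁, C₂, Q, δ, hC₁, hC₂, hQ, hδ, fun msq hm hcap eM nn m src tgt hconn κ hsub Υ _ _ vtx υ₀ hυ₀ b κe K => ?_⟩
  set jv : KingVolIndex d := jvSucc (d := d) eM K with hjv
  haveI := kingVol_neZero L jv
  have key := H msq hm hcap jv nn m src tgt hconn κ hsub Υ vtx υ₀ hυ₀ b κe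
  have hprod : ∏ _υ ∈ (univ : Finset Υ).erase υ₀, Q = Q ^ (Fintype.card Υ - 1) := by
    rw [prod_const, card_erase_of_mem (mem_univ _), card_univ]
  rw [hprod] at key
  have htree := exp_treeLength_le_exp_inf L eM b K hδ.le
  have hS0 : 0 ≤ (Q * c368 d δ) * (C₁ ^ m * C₂ ^ nn
      * (∑ π : Equiv.Perm (Fin m), degConst L (kingDegList src tgt ((d + 1 : ℕ) : ℝ) (fun ℓ => lineExp (d + 1) (κ ℓ)) π)) * Q ^ (Fintype.card Υ - 1)) := by
    have hdeg : 0 ≤ ∑ π : Equiv.Perm (Fin m), degConst L (kingDegList src tgt ((d + 1 : ℕ) : ℝ) (fun ℓ => lineExp (d + 1) (κ ℓ)) π) :=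
      sum_nonneg fun π _ => zero_le_one.trans (one_le_degConst L hL
        (posDegrees_of_posDegreesBy le_rfl (posDegreesBy_kingDegList_of_posSubgraphsBy le_rfl hsub π)))
    have := c368_pos d hδ
    positivity
  unfold kingLegSeq
  calc _ ≤ _ := key
    _ ≤ _ := by rw [mul_comm]; exact mul_le_mul_of_nonneg_left htree hS0

end Bounds

/-! ## §3 The continuum n-point kernel with the full-rate tree factor -/

section Limit

/-- ★★ **THE CONTINUUM n-POINT KERNEL EXISTS, WITH RATE AND FULL-RATE TREE DECAY AGAINST THE LIMIT**: with part Α-g's `(A, γ, δ)`, under p. 664's sentence, there is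
`E^{(∞)}(G; {b_υ})` with `E^{(K+1)} → E^{(∞)}` and `|E^{(K+1)} − E^{(∞)}| ≤ ((A^{2m+nn+|Υ|}m!(m+|Υ|+1))·L^{−γ}·exp[−δ·d_tree^{(∞)}({b_υ})])·(L^{−γ})^K∕(1 − L^{−γ})` for every `K`.
[cite: King1986, Thm 2.1 (i) (2.22) p.654, (3.13) p.657, Prop. 3.6 (3.56) p.662, p.660] -/
theorem king_graphLegs_continuumLimit_inf (hLodd : Odd L) (hL : 2 ≤ L) {a : ℝ} (ha : 0 < a) {m0sq : ℝ} (hm0 : 0 ≤ m0sq) :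
    ∃ A γ δ : ℝ, 1 ≤ A ∧ 0 < γ ∧ 0 < δ ∧ ∀ (msq : ℝ), 0 < msq → msq ≤ m0sq → ∀ (eM nn m : ℕ) (src tgt : Fin m → Fin (nn + 1)), (∀ v, LConn src tgt univ 0 v) →
      ∀ (κ : Fin m → Option (Fin (d + 1))), PosSubgraphsBy src tgt 0 ((d + 1 : ℕ) : ℝ) (fun ℓ => lineExp (d + 1) (κ ℓ)) →
      ∀ (Υ : Type) [Fintype Υ] [DecidableEq Υ] (vtx : Υ → Fin (nn + 1)) (υ₀ : Υ), vtx υ₀ = 0 →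
      ∀ (b : Υ → Tor (kingVol L (jvSucc (d := d) eM 0))) (κe : Υ → Option (Fin (d + 1))),
      ∃ Einf : ℝ, Tendsto (kingLegSeq L a msq eM nn m src tgt κ Υ vtx b κe) atTop (𝓝 Einf) ∧
        ∀ K : ℕ, |kingLegSeq L a msq eM nn m src tgt κ Υ vtx b κe K - Einf|
          ≤ ((A ^ (2 * m + nn + Fintype.card Υ) * ((m.factorial : ℝ) * (m + Fintype.card Υ + 1))) * (L : ℝ) ^ (-γ)
              * Real.exp (-(δ * kingTreeDistInf L eM b))) * ((L : ℝ) ^ (-γ)) ^ K / (1 - (L : ℝ) ^ (-γ)) := by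
  obtain ⟨A, γ, δ, hA, hγ, hδ, H⟩ := kingLegSeq_succ_sub_le_inf (d := d) L hLodd hL ha hm0
  refine ⟨A, γ, δ, hA, hγ, hδ, fun msq hm hcap eM nn m src tgt hconn κ hsub Υ _ _ vtx υ₀ hυ₀ b κe => ?_⟩
  have hL1r : (1 : ℝ) < L := by exact_mod_cast (show 1 < L by omega)
  have hr1 : (L : ℝ) ^ (-γ) < 1 := Real.rpow_lt_one_of_one_lt_of_neg hL1r (by linarith)
  set C : ℝ := (A ^ (2 * m + nn + Fintype.card Υ) * ((m.factorial : ℝ) * (m + Fintype.card Υ + 1))) * (L : ℝ) ^ (-γ)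
      * Real.exp (-(δ * kingTreeDistInf L eM b)) with hC
  have hdistK : ∀ K, dist (kingLegSeq L a msq eM nn m src tgt κ Υ vtx b κe K) (kingLegSeq L a msq eM nn m src tgt κ Υ vtx b κe (K + 1))
      ≤ C * ((L : ℝ) ^ (-γ)) ^ K := fun K => by
    rw [Real.dist_eq, abs_sub_comm]; exact H msq hm hcap eM nn m src tgt hconn κ hsub Υ vtx υ₀ hυ₀ b κe K
  obtain ⟨Einf, hlim⟩ := cauchySeq_tendsto_of_complete (cauchySeq_of_le_geometric _ C hr1 hdistK)
  refine ⟨Einf, hlim, fun K => ?_⟩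
  rw [← Real.dist_eq]
  exact dist_le_of_le_geometric_of_tendsto _ C hr1 hdistK hlim K

/-- ★★★ **TREE DECAY OF THE CONTINUUM n-POINT KERNEL AT THE FULL RATE — (3.38)∕(3.56)'s `exp[−δ dist({y_i})]` FOR THE LIMIT, `dist = d_tree^{(∞)}`, UNIFORMLY IN THE
VOLUME.**  With part Α-l's `(C₁, C₂, Q, δ′)`: for every mass, volume exponent, CONNECTED numbered graph under p. 664's sentence, family `Υ` of King's legs (root at the
vertex `0`) at unit sites `b_υ` and every limit point `E^{(∞)}` of `E^{(K+1)}(G; {y_b})`: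
`|E^{(∞)}(G; {b_υ})| ≤ ((Q·c368 δ′)·C₁^m C₂^{nn}·(Σ_π degConst)·Q^{|Υ|−1})·exp[−δ′·d_tree^{(∞)}({b_υ})]`, where `d_tree^{(∞)} ≥ |b_{υ₁} − b_{υ₂}|_T − 1` for every pair and
`|Υ|(d_tree^{(∞)} + 1) ≥ treeLength |·|_T (b(Υ))` (§1). [cite: King1986, Thm 3.5 (3.38) p.660, p.660 («shortest tree graph»), Prop. 3.6 (3.56) p.662, (3.13) p.657] -/
theorem king_graphLegs_limit_treeDecayInf (hLodd : Odd L) (hL : 2 ≤ L) {a : ℝ} (ha : 0 < a) {m0sq : ℝ} (hm0 : 0 ≤ m0sq) :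
    ∃ C₁ C₂ Q δ : ℝ, 0 < C₁ ∧ 0 < C₂ ∧ 0 < Q ∧ 0 < δ ∧ ∀ (msq : ℝ), 0 < msq → msq ≤ m0sq →
      ∀ (eM nn m : ℕ) (src tgt : Fin m → Fin (nn + 1)), (∀ v, LConn src tgt univ 0 v) →
      ∀ (κ : Fin m → Option (Fin (d + 1))), PosSubgraphsBy src tgt 0 ((d + 1 : ℕ) : ℝ) (fun ℓ => lineExp (d + 1) (κ ℓ)) →
      ∀ (Υ : Type) [Fintype Υ] [DecidableEq Υ] (vtx : Υ → Fin (nn + 1)) (υ₀ : Υ), vtx υ₀ = 0 →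
      ∀ (b : Υ → Tor (kingVol L (jvSucc (d := d) eM 0))) (κe : Υ → Option (Fin (d + 1))),
      ∀ Einf : ℝ, Tendsto (kingLegSeq L a msq eM nn m src tgt κ Υ vtx b κe) atTop (𝓝 Einf) →
        |Einf| ≤ ((Q * c368 d δ) * (C₁ ^ m * C₂ ^ nn
                * (∑ π : Equiv.Perm (Fin m), degConst L (kingDegList src tgt ((d + 1 : ℕ) : ℝ) (fun ℓ => lineExp (d + 1) (κ ℓ)) π))
                * Q ^ (Fintype.card Υ - 1))) * Real.exp (-(δ * kingTreeDistInf L eM b)) := by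
  obtain ⟨C₁, C₂, Q, δ, hC₁, hC₂, hQ, hδ, H⟩ := kingLegSeq_abs_le_inf (d := d) L hLodd hL ha hm0
  refine ⟨C₁, C₂, Q, δ, hC₁, hC₂, hQ, hδ, fun msq hm hcap eM nn m src tgt hconn κ hsub Υ _ _ vtx υ₀ hυ₀ b κe Einf hlim => ?_⟩
  exact le_of_tendsto ((continuous_abs.tendsto Einf).comp hlim)
    (Eventually.of_forall fun K => H msq hm hcap eM nn m src tgt hconn κ hsub Υ vtx υ₀ hυ₀ b κe K)

end Limit

/-! ## §4 The hypothesis-free class: connected pseudoforests of `G`-lines, `1 ≤ d ≤ 3` -/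

section Pseudoforest

/-- ★★ **FULL-RATE TREE DECAY OF THE CONTINUUM KERNEL OF EVERY CONNECTED PSEUDOFOREST OF `G`-LINES WITH KING's LEGS — NO HYPOTHESIS** (`1 ≤ d ≤ 3`).
[cite: King1986, Thm 3.5 (3.38) p.660, p.660 (dist), Prop. 3.6 (3.56) p.662, p.664] -/
theorem king_pseudoforestLegs_limit_treeDecayInf (hd1 : 1 ≤ d) (hd3 : d ≤ 3) (hLodd : Odd L) (hL : 2 ≤ L) {a : ℝ} (ha : 0 < a)
    {m0sq : ℝ} (hm0 : 0 ≤ m0sq) :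
    ∃ C₁ C₂ Q δ : ℝ, 0 < C₁ ∧ 0 < C₂ ∧ 0 < Q ∧ 0 < δ ∧ ∀ (msq : ℝ), 0 < msq → msq ≤ m0sq →
      ∀ (eM nn m : ℕ) (src tgt : Fin m → Fin (nn + 1)), (∀ v, LConn src tgt univ 0 v) →
      (∀ ℓ, src ℓ ≠ tgt ℓ) → (∀ S : Finset (Fin m), S.card ≤ (lineVerts src tgt S).card) →
      (∀ S : Finset (Fin m), S.card = 2 → 3 ≤ (lineVerts src tgt S).card) →
      ∀ (Υ : Type) [Fintype Υ] [DecidableEq Υ] (vtx : Υ → Fin (nn + 1)) (υ₀ : Υ), vtx υ₀ = 0 →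
      ∀ (b : Υ → Tor (kingVol L (jvSucc (d := d) eM 0))) (κe : Υ → Option (Fin (d + 1))),
      ∀ Einf : ℝ, Tendsto (kingLegSeq L a msq eM nn m src tgt (fun _ : Fin m => (none : Option (Fin (d + 1)))) Υ vtx b κe) atTop (𝓝 Einf) →
        |Einf| ≤ ((Q * c368 d δ) * (C₁ ^ m * C₂ ^ nn
                * (∑ π : Equiv.Perm (Fin m), degConst L (kingDegList src tgt ((d + 1 : ℕ) : ℝ)
                    (fun ℓ => lineExp (d + 1) ((fun _ : Fin m => (none : Option (Fin (d + 1)))) ℓ)) π))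
                * Q ^ (Fintype.card Υ - 1))) * Real.exp (-(δ * kingTreeDistInf L eM b)) := by
  obtain ⟨C₁, C₂, Q, δ, hC₁, hC₂, hQ, hδ, H⟩ := king_graphLegs_limit_treeDecayInf (d := d) L hLodd hL ha hm0
  refine ⟨C₁, C₂, Q, δ, hC₁, hC₂, hQ, hδ, fun msq hm hcap eM nn m src tgt hconn h1 h2 h3 Υ _ _ vtx υ₀ hυ₀ b κe Einf hlim => ?_⟩
  exact H msq hm hcap eM nn m src tgt hconn _ (posSubgraphsBy_lineExp_pseudoforest hd1 hd3 h1 h2 h3) Υ vtx υ₀ hυ₀ b κe Einf hlim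

end Pseudoforest

end Summit.QuantumFields.YangMills.BalabanUVNodes.N15KingModelRung.Curved

end
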